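import Summits.Parity.BatemanHorn.Theorems.AlmostPrimeZerosDefs
import Summits.Parity.BatemanHorn.Theorems.SelbergDelangeRigidityLSDRealSegmentTypeI
import Literature.NumberTheory.Sieve.BatemanHornProofs
import HarnessLib

/-!
# Route `AlmostPrimeZeros`, crux `SystemLSDRealSegment` (stmt-Parity-11292), line
# `beta-thinned-root-kernel`: the registered stub `stub_typeILimit` (analytic assembly of `TypeILaw`)

For a Bateman–Horn system `f = (f₁,…,f_k)` and real `y > 1` we assemble the level-`x` half of the
real-segment law, `TypeILaw k f y`:
`x⁻¹ (log x)^{k(1−y)} T_x(y) → λ_f(y) / Γ(k(y−1)+1)`,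
from the four inputs of the line taken as HYPOTHESES (each is a registered stub proved elsewhere):
the sandwich `TypeISandwich` (`T_x = (x+1) G(x) + O(1 + H(x))`, `G(x) = Σ_{m≤x} b(m)`,
`H(x) = Σ_{m≤x} m b(m)`), the local structure `TypeILocal` of `b = bCoeff f y`, Landau's
`RootMertens` for every member `fᵢ`, and the Levin–Faĭnleĭb mean-value theorem `LevinFainleibAsymp`.

Proof (`κ = k(y−1) ≥ 0`).
1. (H1) `Σ_{p≤Q} b(p) log p − κ log Q = (y−1) Σᵢ [Σ_{p≤Q} ρᵢ(p) log p/p − log Q]` is bounded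
   (`b(p) = (y−1)Σᵢρᵢ(p)/p` and `RootMertens (fᵢ)`).
2. (H2) `b(p) ≤ C₁/p` at every prime (`ρᵢ(p) ≤ deg fᵢ + |lc fᵢ|`: Lagrange when `p ∤ lc fᵢ`, else
   `ρᵢ(p) ≤ p ≤ |lc fᵢ|`), and `b(p^ν) ≤ C₂/p²` for `ν ≥ 2` at EVERY prime (beyond the threshold by
   `TypeILocal`; below it there are finitely many non-zero values, `b(p^ν) = 0` for `ν > 2k`); hence both
   prime sums of (H2) are `≪ Σ_p log p/p² < ∞`.
3. Levin–Faĭnleĭb gives `P = lim ∏_{p≤N} (Σ_ν b(p^ν))(1 − 1/p)^κ` and `G(x) ∼ (P/Γ(κ+1)) (log x)^κ`;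
   the complex partial products of `eulerFactor f y` are these real products cast to `ℂ`
   (`Σ_ν b(p^ν) = Σ_{ν≤2k} b(p^ν) = E_p(y)`), so `λ_f(y) = P` (`Filter.Tendsto.limUnder_eq`).
4. `H(x) = o(x (log x)^κ)` from the asymptotics of `G` alone
   (`ProductAnatomySubcritical.tendsto_sum_mul_div_of_tendsto`), `(x+1)/x → 1`, the normaliser
   `x⁻¹ e^{k(1−y) log log x} = (x (log x)^κ)⁻¹` for `x ≥ 2` (`ProductAnatomySubcritical.normaliser_ofReal_eq`),
   and the cast `ℝ → ℂ` with `Γ(κ+1)` real (`Complex.Gamma_ofReal`).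

References: H. Halberstam, H.-E. Richert, *Sieve Methods* (1974) Lemma 5.4; G. Tenenbaum,
*Introduction to analytic and probabilistic number theory* (2015) II.5–II.6.
-/

open Filter Finset Polynomial
open scoped BigOperators Topology

namespace Summit.Parity.BatemanHorn.Cruxes.SystemLSDRealSegment.BetaThinnedRootKernel

open Literature.NumberTheory.Sieve
open Summit.Parity.BatemanHorn.Cruxes.LSDRealSegment.ProductAnatomySubcritical
  (tendsto_sum_mul_div_of_tendsto normaliser_ofReal_eq summable_log_div_sq)

noncomputable section

variable {k : ℕ}

/-! ### (H1): the prime mean of `b` is `κ = k(y−1)` -/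

/-- **(H1) for `b = bCoeff f y`**: if `b(p) = (y−1)Σᵢρᵢ(p)/p` at every prime and each `ρᵢ` satisfies
Landau–Mertens `|Σ_{p≤Q} ρᵢ(p) log p/p − log Q| ≤ Cᵢ`, then
`|Σ_{p≤Q} b(p) log p − k(y−1) log Q| ≤ (y−1)ΣᵢCᵢ` for `Q ≥ 2`. [folklore] -/
theorem bCoeff_primeMean (f : Fin k → ℤ[X]) {y : ℝ} (hy : 1 ≤ y)
    (hbp : ∀ p : ℕ, p.Prime → bCoeff f y p = (y - 1) * ∑ i, (polyRootCountMod ![f i] p : ℝ) / p)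
    (hRM : ∀ i, ∃ C : ℝ, ∀ Q : ℕ, 2 ≤ Q →
      |(∑ p ∈ Nat.primesLE Q, (polyRootCountMod ![f i] p : ℝ) * Real.log p / p) - Real.log Q| ≤ C) :
    ∃ L : ℝ, ∀ Q : ℕ, 2 ≤ Q →
      |(∑ p ∈ Nat.primesLE Q, bCoeff f y p * Real.log p) - (k : ℝ) * (y - 1) * Real.log Q| ≤ L := by
  choose Cf hCf using hRM
  refine ⟨(y - 1) * ∑ i, Cf i, fun Q hQ => ?_⟩
  have hS : ∑ p ∈ Nat.primesLE Q, bCoeff f y p * Real.log p =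
      (y - 1) * ∑ i, ∑ p ∈ Nat.primesLE Q, (polyRootCountMod ![f i] p : ℝ) * Real.log p / p := by
    rw [Finset.sum_comm, Finset.mul_sum]
    refine Finset.sum_congr rfl fun p hp => ?_
    rw [hbp p (Nat.prime_of_mem_primesLE hp), Finset.mul_sum, Finset.mul_sum, Finset.sum_mul]
    refine Finset.sum_congr rfl fun i _ => ?_
    ring
  have hK : (k : ℝ) * (y - 1) * Real.log Q = (y - 1) * ∑ _i : Fin k, Real.log Q := by
    rw [Finset.sum_const, Finset.card_univ, Fintype.card_fin, nsmul_eq_mul]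
    ring
  have hy0 : 0 ≤ y - 1 := by linarith
  rw [hS, hK, ← mul_sub, ← Finset.sum_sub_distrib, abs_mul, abs_of_nonneg hy0]
  refine mul_le_mul_of_nonneg_left ?_ hy0
  exact (Finset.abs_sum_le_sum_abs _ _).trans (Finset.sum_le_sum fun i _ => hCf i Q hQ)

/-! ### (H2): uniform bounds `b(p) ≤ C₁/p`, `b(p^ν) ≤ C₂/p²` and the prime-power sums -/

/-- `ρ_g(p) ≤ deg g + |lc g|` at every prime for `g ≠ 0`: Lagrange (`polyRootCountMod_single_le_natDegree`)
when `p ∤ lc g`, otherwise `ρ_g(p) ≤ p ≤ |lc g|`. [folklore] -/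
theorem polyRootCountMod_single_le_natDegree_add {g : ℤ[X]} (hg : g ≠ 0) {p : ℕ} (hp : p.Prime) :
    polyRootCountMod ![g] p ≤ g.natDegree + g.leadingCoeff.natAbs := by
  by_cases h : (p : ℤ) ∣ g.leadingCoeff
  · have h2 : p ≤ g.leadingCoeff.natAbs :=
      Nat.le_of_dvd (Int.natAbs_pos.mpr (leadingCoeff_ne_zero.mpr hg)) (Int.natCast_dvd.mp h)
    exact (polyRootCountMod_le _ _).trans (h2.trans (Nat.le_add_left _ _))
  · exact (polyRootCountMod_single_le_natDegree hp h).trans (Nat.le_add_right _ _)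

/-- `b(p) ≤ (y−1)(Σᵢ (deg fᵢ + |lc fᵢ|))/p` at every prime, from `b(p) = (y−1)Σᵢρᵢ(p)/p`. [folklore] -/
theorem bCoeff_prime_le (f : Fin k → ℤ[X]) (hf0 : ∀ i, f i ≠ 0) {y : ℝ} (hy : 1 ≤ y)
    (hbp : ∀ p : ℕ, p.Prime → bCoeff f y p = (y - 1) * ∑ i, (polyRootCountMod ![f i] p : ℝ) / p)
    {p : ℕ} (hp : p.Prime) :
    bCoeff f y p ≤
      (y - 1) * (∑ i, (((f i).natDegree + (f i).leadingCoeff.natAbs : ℕ) : ℝ)) / p := by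
  have hp0 : (0 : ℝ) < p := by exact_mod_cast hp.pos
  rw [hbp p hp, mul_div_assoc, ← Finset.sum_div]
  refine mul_le_mul_of_nonneg_left (div_le_div_of_nonneg_right
    (Finset.sum_le_sum fun i _ => ?_) hp0.le) (by linarith)
  exact_mod_cast polyRootCountMod_single_le_natDegree_add (hf0 i) hp

/-- A non-negative `b` with `b(p^ν) = 0` for `ν > K` and `b(p^ν) ≤ C/p²` (`ν ≥ 2`) beyond a threshold `P₀`
satisfies `b(p^ν) ≤ C'/p²` for `ν ≥ 2` at EVERY prime, `C' ≥ 0` (below the threshold only the finitely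
many values `b(p^ν) p²`, `p ≤ P₀`, `ν ≤ K`, occur). [folklore] -/
theorem exists_prime_pow_le_div_sq {b : ℕ → ℝ} (hb0 : ∀ m, 0 ≤ b m) {K : ℕ}
    (hbz : ∀ p : ℕ, p.Prime → ∀ ν : ℕ, K < ν → b (p ^ ν) = 0)
    (hP : ∃ P₀ : ℕ, ∃ C : ℝ, ∀ p : ℕ, p.Prime → P₀ < p → ∀ ν : ℕ, 2 ≤ ν →
      b (p ^ ν) ≤ C / (p : ℝ) ^ 2) :
    ∃ C' : ℝ, 0 ≤ C' ∧ ∀ p : ℕ, p.Prime → ∀ ν : ℕ, 2 ≤ ν → b (p ^ ν) ≤ C' / (p : ℝ) ^ 2 := by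
  obtain ⟨P₀, C, hC⟩ := hP
  set M : ℝ := ∑ p ∈ Nat.primesLE P₀, ∑ ν ∈ range (K + 1), b (p ^ ν) * (p : ℝ) ^ 2 with hM
  have hin : ∀ p : ℕ, 0 ≤ ∑ ν ∈ range (K + 1), b (p ^ ν) * (p : ℝ) ^ 2 := fun p =>
    Finset.sum_nonneg fun ν _ => mul_nonneg (hb0 _) (sq_nonneg _)
  have hM0 : 0 ≤ M := Finset.sum_nonneg fun p _ => hin p
  refine ⟨max C 0 + M, by positivity, fun p hp ν hν => ?_⟩
  have hp0 : (0 : ℝ) < (p : ℝ) ^ 2 := by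
    have := hp.pos
    positivity
  rcases lt_or_ge K ν with hKν | hKν
  · rw [hbz p hp ν hKν]
    positivity
  rcases lt_or_ge P₀ p with hPp | hPp
  · calc b (p ^ ν) ≤ C / (p : ℝ) ^ 2 := hC p hp hPp ν hν
      _ ≤ (max C 0 + M) / (p : ℝ) ^ 2 :=
          div_le_div_of_nonneg_right ((le_max_left _ _).trans (le_add_of_nonneg_right hM0)) hp0.le
  · have h1 : b (p ^ ν) * (p : ℝ) ^ 2 ≤ M :=
      calc b (p ^ ν) * (p : ℝ) ^ 2 ≤ ∑ μ ∈ range (K + 1), b (p ^ μ) * (p : ℝ) ^ 2 :=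
            Finset.single_le_sum (f := fun μ => b (p ^ μ) * (p : ℝ) ^ 2)
              (fun μ _ => mul_nonneg (hb0 _) (sq_nonneg _)) (Finset.mem_range.mpr (by omega))
        _ ≤ M := Finset.single_le_sum (f := fun q => ∑ μ ∈ range (K + 1), b (q ^ μ) * (q : ℝ) ^ 2)
            (fun q _ => hin q) (Nat.mem_primesLE.mpr ⟨hPp, hp⟩)
    rw [le_div_iff₀ hp0]
    exact h1.trans (le_add_of_nonneg_left (le_max_right _ _))

/-- **(H2)** for a non-negative `b` with `b(p) ≤ C₁/p`, `b(p^ν) ≤ C₂/p²` (`ν ≥ 2`, `C₂ ≥ 0`) at every prime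
and `b(p^ν) = 0` for `ν > K`: the partial sums `Σ_{p≤N} b(p)² log p + Σ_{p≤N} Σ_{2≤ν≤N} b(p^ν) log p^ν` are
bounded (both are `≪ Σ_p log p / p² < ∞`). [folklore] -/
theorem exists_primePowers_le {b : ℕ → ℝ} (hb0 : ∀ m, 0 ≤ b m) {K : ℕ}
    (hbz : ∀ p : ℕ, p.Prime → ∀ ν : ℕ, K < ν → b (p ^ ν) = 0)
    {C₁ : ℝ} (hb1 : ∀ p : ℕ, p.Prime → b p ≤ C₁ / p)
    {C₂ : ℝ} (hC₂ : 0 ≤ C₂) (hb2 : ∀ p : ℕ, p.Prime → ∀ ν : ℕ, 2 ≤ ν → b (p ^ ν) ≤ C₂ / (p : ℝ) ^ 2) :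
    ∃ A : ℝ, ∀ N : ℕ, (∑ p ∈ Nat.primesLE N, b p ^ 2 * Real.log p) +
      (∑ p ∈ Nat.primesLE N, ∑ ν ∈ Icc 2 N, b (p ^ ν) * Real.log ((p : ℝ) ^ ν)) ≤ A := by
  set S : ℝ := ∑' n : ℕ, Real.log n / (n : ℝ) ^ 2 with hS
  refine ⟨(C₁ ^ 2 + (K + 1) * (C₂ * K)) * S, fun N => ?_⟩
  -- `b(p)² log p ≤ C₁² log p / p²`
  have key1 : ∀ p : ℕ, p.Prime → b p ^ 2 * Real.log p ≤ C₁ ^ 2 * (Real.log p / (p : ℝ) ^ 2) := by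
    intro p hp
    have hp0 : (0 : ℝ) < p := by exact_mod_cast hp.pos
    have hlog : 0 ≤ Real.log p := Real.log_natCast_nonneg p
    calc b p ^ 2 * Real.log p ≤ (C₁ / p) ^ 2 * Real.log p :=
          mul_le_mul_of_nonneg_right (pow_le_pow_left₀ (hb0 p) (hb1 p hp) 2) hlog
      _ = C₁ ^ 2 * (Real.log p / (p : ℝ) ^ 2) := by
          field_simp
  -- `Σ_{2 ≤ ν ≤ N} b(p^ν) log p^ν ≤ (K+1) C₂ K log p / p²`
  have key2 : ∀ p : ℕ, p.Prime → ∑ ν ∈ Icc 2 N, b (p ^ ν) * Real.log ((p : ℝ) ^ ν) ≤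
      (K + 1) * (C₂ * K) * (Real.log p / (p : ℝ) ^ 2) := by
    intro p hp
    have hp0 : (0 : ℝ) < p := by exact_mod_cast hp.pos
    have hlog : 0 ≤ Real.log p := Real.log_natCast_nonneg p
    have hsub : (Icc 2 N).filter (fun ν => ν ≤ K) ⊆ range (K + 1) := fun ν hν => by
      simp only [Finset.mem_filter, Finset.mem_range] at hν ⊢
      omega
    have hcard : (#((Icc 2 N).filter (fun ν => ν ≤ K)) : ℝ) ≤ K + 1 := by
      exact_mod_cast (Finset.card_le_card hsub).trans (Finset.card_range _).le
    have hD0 : 0 ≤ C₂ * K * (Real.log p / (p : ℝ) ^ 2) := by positivity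
    calc ∑ ν ∈ Icc 2 N, b (p ^ ν) * Real.log ((p : ℝ) ^ ν)
        = ∑ ν ∈ (Icc 2 N).filter (fun ν => ν ≤ K), b (p ^ ν) * Real.log ((p : ℝ) ^ ν) := by
          rw [Finset.sum_filter_of_ne]
          intro ν _ hne
          by_contra hKν
          exact hne (by rw [hbz p hp ν (not_le.mp hKν), zero_mul])
      _ ≤ ∑ _ν ∈ (Icc 2 N).filter (fun ν => ν ≤ K), C₂ * K * (Real.log p / (p : ℝ) ^ 2) := by
          refine Finset.sum_le_sum fun ν hν => ?_
          simp only [Finset.mem_filter, Finset.mem_Icc] at hν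
          have hνK : (ν : ℝ) ≤ K := by exact_mod_cast hν.2
          rw [Real.log_pow]
          calc b (p ^ ν) * (ν * Real.log p) ≤ C₂ / (p : ℝ) ^ 2 * (K * Real.log p) :=
                mul_le_mul (hb2 p hp ν hν.1.1) (mul_le_mul_of_nonneg_right hνK hlog)
                  (by positivity) (by positivity)
            _ = C₂ * K * (Real.log p / (p : ℝ) ^ 2) := by ring
      _ = #((Icc 2 N).filter (fun ν => ν ≤ K)) * (C₂ * K * (Real.log p / (p : ℝ) ^ 2)) := by
          rw [Finset.sum_const, nsmul_eq_mul]
      _ ≤ (K + 1) * (C₂ * K * (Real.log p / (p : ℝ) ^ 2)) := mul_le_mul_of_nonneg_right hcard hD0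
      _ = (K + 1) * (C₂ * K) * (Real.log p / (p : ℝ) ^ 2) := by ring
  -- sum over the primes
  have hlogsum : ∑ p ∈ Nat.primesLE N, Real.log p / (p : ℝ) ^ 2 ≤ S :=
    summable_log_div_sq.sum_le_tsum _ fun n _ => div_nonneg (Real.log_natCast_nonneg n) (sq_nonneg _)
  have hK0 : 0 ≤ C₁ ^ 2 + (K + 1) * (C₂ * K) := by positivity
  calc (∑ p ∈ Nat.primesLE N, b p ^ 2 * Real.log p) +
        (∑ p ∈ Nat.primesLE N, ∑ ν ∈ Icc 2 N, b (p ^ ν) * Real.log ((p : ℝ) ^ ν))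
      ≤ (∑ p ∈ Nat.primesLE N, C₁ ^ 2 * (Real.log p / (p : ℝ) ^ 2)) +
          ∑ p ∈ Nat.primesLE N, (K + 1) * (C₂ * K) * (Real.log p / (p : ℝ) ^ 2) :=
        add_le_add (Finset.sum_le_sum fun p hp => key1 p (Nat.prime_of_mem_primesLE hp))
          (Finset.sum_le_sum fun p hp => key2 p (Nat.prime_of_mem_primesLE hp))
    _ = (C₁ ^ 2 + (K + 1) * (C₂ * K)) * ∑ p ∈ Nat.primesLE N, Real.log p / (p : ℝ) ^ 2 := by
        rw [← Finset.mul_sum, ← Finset.mul_sum]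
        ring
    _ ≤ (C₁ ^ 2 + (K + 1) * (C₂ * K)) * S := mul_le_mul_of_nonneg_left hlogsum hK0

/-- **(H2) for `b = bCoeff f y`** from the local structure `TypeILocal`-style data: non-negativity,
`b(p) = (y−1)Σᵢρᵢ(p)/p`, vanishing for `ν > 2k`, and `b(p^ν) ≤ C/p²` beyond a threshold. [folklore] -/
theorem bCoeff_primePowers (f : Fin k → ℤ[X]) (hf0 : ∀ i, f i ≠ 0) {y : ℝ} (hy : 1 ≤ y)
    (hb0 : ∀ m, 0 ≤ bCoeff f y m)
    (hbp : ∀ p : ℕ, p.Prime → bCoeff f y p = (y - 1) * ∑ i, (polyRootCountMod ![f i] p : ℝ) / p)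
    (hbz : ∀ p : ℕ, p.Prime → ∀ ν : ℕ, 2 * k < ν → bCoeff f y (p ^ ν) = 0)
    (hP : ∃ P₀ : ℕ, ∃ C : ℝ, ∀ p : ℕ, p.Prime → P₀ < p → ∀ ν : ℕ, 2 ≤ ν →
      bCoeff f y (p ^ ν) ≤ C / (p : ℝ) ^ 2) :
    ∃ A : ℝ, ∀ N : ℕ, (∑ p ∈ Nat.primesLE N, bCoeff f y p ^ 2 * Real.log p) +
      (∑ p ∈ Nat.primesLE N, ∑ ν ∈ Icc 2 N, bCoeff f y (p ^ ν) * Real.log ((p : ℝ) ^ ν)) ≤ A := by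
  obtain ⟨C₂, hC₂, hb2⟩ := exists_prime_pow_le_div_sq hb0 hbz hP
  exact exists_primePowers_le hb0 hbz (fun p hp => bCoeff_prime_le f hf0 hy hbp hp) hC₂ hb2

/-! ### The constant: `λ_f(y)` is the real Levin–Faĭnleĭb product -/

/-- At a real point `y`, if `E_p(y) = Σ_{ν≤2k} b(p^ν)` and `b(p^ν) = 0` for `ν > 2k`, the complex partial
products of `λ_f = eulerFactor f` are the real products `∏_{p≤N} (Σ_ν b(p^ν))(1 − 1/p)^{k(y−1)}` cast to
`ℂ`; hence `λ_f(y)` IS their limit `P`. [folklore] -/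
theorem eulerFactor_ofReal_eq_of_tendsto (f : Fin k → ℤ[X]) (y : ℝ) {b : ℕ → ℝ}
    (hbz : ∀ p : ℕ, p.Prime → ∀ ν : ℕ, 2 * k < ν → b (p ^ ν) = 0)
    (hloc : ∀ p : ℕ, p.Prime →
      localFactor f p (y : ℂ) = ((∑ ν ∈ range (2 * k + 1), b (p ^ ν) : ℝ) : ℂ))
    {P : ℝ} (hP : Tendsto (fun N : ℕ => ∏ p ∈ Nat.primesLE N,
      (∑' ν : ℕ, b (p ^ ν)) * (1 - 1 / (p : ℝ)) ^ ((k : ℝ) * (y - 1))) atTop (𝓝 P)) :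
    eulerFactor f (y : ℂ) = (P : ℂ) := by
  unfold eulerFactor
  refine (((Complex.continuous_ofReal.tendsto P).comp hP).congr fun N => ?_).limUnder_eq
  rw [Function.comp_apply, Complex.ofReal_prod]
  refine Finset.prod_congr rfl fun p hp => ?_
  have hp' := Nat.prime_of_mem_primesLE hp
  have hc : (0 : ℝ) < 1 - 1 / (p : ℝ) := by
    have h2 : (2 : ℝ) ≤ p := by exact_mod_cast hp'.two_le
    rw [sub_pos, div_lt_one (by linarith)]
    linarith
  have htsum : ∑' ν : ℕ, b (p ^ ν) = ∑ ν ∈ range (2 * k + 1), b (p ^ ν) :=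
    tsum_eq_sum fun ν hν => hbz p hp' ν (by simpa using hν)
  rw [Complex.ofReal_mul, htsum, ← hloc p hp', Real.rpow_def_of_pos hc, Complex.ofReal_exp]
  congr 2
  push_cast
  ring

/-! ### The registered stub -/

/-- **stub_typeILimit** (registered stub of the checked skeleton, line `beta-thinned-root-kernel`): GIVEN the
sandwich `TypeISandwich`, the local structure `TypeILocal`, Landau's `RootMertens` for every polynomial and
the Levin–Faĭnleĭb theorem `LevinFainleibAsymp`, for every Bateman–Horn system `f` and every real `y > 1`
the level-`x` half of the real-segment law holds:
`x⁻¹ (log x)^{k(1−y)} T_x(y) → λ_f(y) / Γ(k(y−1)+1)` (`TypeILaw k f y`). [folklore] -/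
theorem stub_typeILimit :
    (∀ (k : ℕ) (f : Fin k → ℤ[X]), IsBatemanHornSystem f → ∀ y : ℝ, 1 ≤ y → TypeISandwich k f y) →
    (∀ (k : ℕ) (f : Fin k → ℤ[X]), IsBatemanHornSystem f → ∀ y : ℝ, 1 ≤ y → TypeILocal k f y) →
    (∀ g : ℤ[X], RootMertens g) → (∀ (g : ℕ → ℝ) (κ : ℝ), LevinFainleibAsymp g κ) →
    ∀ (k : ℕ) (f : Fin k → ℤ[X]), IsBatemanHornSystem f → ∀ y : ℝ, 1 < y → TypeILaw k f y := by
  intro hSand hLoc hRM hLF k f hf y hy1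
  have hy : 1 ≤ y := hy1.le
  have hκ0 : 0 ≤ (k : ℝ) * (y - 1) := mul_nonneg (Nat.cast_nonneg _) (by linarith)
  obtain ⟨C, hC⟩ := hSand k f hf y hy
  obtain ⟨hb0, hb1, hbmul, hbp, hbz, hbpow, hloc⟩ := hLoc k f hf y hy
  have hf0 : ∀ i, f i ≠ 0 := fun i => (hf.irreducible i).ne_zero
  have hH1 := bCoeff_primeMean f hy hbp fun i => hRM (f i) (hf.irreducible i) (hf.natDegree_pos i)
  have hH2 := bCoeff_primePowers f hf0 hy hb0 hbp hbz hbpow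
  obtain ⟨P, hprod, hG⟩ := hLF (bCoeff f y) ((k : ℝ) * (y - 1)) hκ0 hb0 hb1 hbmul hH1 hH2
  have hEuler : eulerFactor f (y : ℂ) = (P : ℂ) := eulerFactor_ofReal_eq_of_tendsto f y hbz hloc hprod
  set κ : ℝ := (k : ℝ) * (y - 1) with hκ
  -- `H(x) = o(x (log x)^κ)` and `1 = o(x (log x)^κ)`
  have hHlim := tendsto_sum_mul_div_of_tendsto (bCoeff f y) hb0 κ hG
  have h1x : Tendsto (fun x : ℕ => 1 / ((x : ℝ) * Real.log x ^ κ)) atTop (𝓝 0) := by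
    refine tendsto_of_tendsto_of_tendsto_of_le_of_le' tendsto_const_nhds tendsto_one_div_atTop_nhds_zero_nat
      ?_ ?_
    · filter_upwards [eventually_ge_atTop 3] with x hx
      have hx3 : (3 : ℝ) ≤ x := by exact_mod_cast hx
      exact div_nonneg zero_le_one
        (mul_nonneg (by linarith) (Real.rpow_nonneg (Real.log_nonneg (by linarith)) _))
    · filter_upwards [eventually_ge_atTop 3] with x hx
      have hx3 : (3 : ℝ) ≤ x := by exact_mod_cast hx
      have hx0 : (0 : ℝ) < x := by linarith
      have hlog1 : 1 ≤ Real.log x := by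
        rw [Real.le_log_iff_exp_le hx0]
        exact Real.exp_one_lt_three.le.trans hx3
      exact one_div_le_one_div_of_le hx0 (le_mul_of_one_le_right hx0.le (Real.one_le_rpow hlog1 hκ0))
  -- the error of the sandwich is `o(x (log x)^κ)`
  have hErr : Tendsto (fun x : ℕ => (typeISum f y x - ((x : ℝ) + 1) * ∑ m ∈ Icc 1 x, bCoeff f y m) /
      ((x : ℝ) * Real.log x ^ κ)) atTop (𝓝 0) := by
    have hmaj : Tendsto (fun x : ℕ => C * (1 / ((x : ℝ) * Real.log x ^ κ) +
        (∑ m ∈ Icc 1 x, (m : ℝ) * bCoeff f y m) / ((x : ℝ) * Real.log x ^ κ))) atTop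
        (𝓝 (C * (0 + 0))) :=
      (h1x.add hHlim).const_mul C
    rw [add_zero, mul_zero] at hmaj
    refine squeeze_zero_norm' ?_ hmaj
    filter_upwards [eventually_ge_atTop 2] with x hx
    have hx2 : (2 : ℝ) ≤ x := by exact_mod_cast hx
    have hx0 : (0 : ℝ) < x := by linarith
    have hL : 0 < Real.log x ^ κ := Real.rpow_pos_of_pos (Real.log_pos (by linarith)) κ
    rw [Real.norm_eq_abs, abs_div, abs_of_pos (mul_pos hx0 hL), ← add_div, mul_div_assoc']
    exact div_le_div_of_nonneg_right (hC x) (mul_pos hx0 hL).le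
  -- `(x + 1)/x → 1`
  have hsucc : Tendsto (fun x : ℕ => ((x : ℝ) + 1) / x) atTop (𝓝 1) := by
    have h : Tendsto (fun x : ℕ => 1 + (x : ℝ)⁻¹) atTop (𝓝 (1 + 0)) :=
      tendsto_const_nhds.add (tendsto_inv_atTop_nhds_zero_nat (𝕜 := ℝ))
    rw [add_zero] at h
    refine h.congr' ?_
    filter_upwards [eventually_ne_atTop 0] with x hx
    have : (x : ℝ) ≠ 0 := by exact_mod_cast hx
    field_simp
  -- the real limit `T_x / (x (log x)^κ) → P / Γ(κ+1)`
  have hreal : Tendsto (fun x : ℕ => typeISum f y x / ((x : ℝ) * Real.log x ^ κ)) atTop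
      (𝓝 (P / Real.Gamma (κ + 1))) := by
    have h := (hsucc.mul hG).add hErr
    rw [one_mul, add_zero] at h
    refine h.congr' ?_
    filter_upwards [eventually_ge_atTop 2] with x hx
    have hx2 : (2 : ℝ) ≤ x := by exact_mod_cast hx
    have hx0 : (x : ℝ) ≠ 0 := by positivity
    have hL : Real.log x ^ κ ≠ 0 := (Real.rpow_pos_of_pos (Real.log_pos (by linarith)) κ).ne'
    field_simp
    ring
  -- pass to `ℂ`
  unfold TypeILaw
  rw [hEuler, show (k : ℂ) * ((y : ℂ) - 1) + 1 = ((κ + 1 : ℝ) : ℂ) by rw [hκ]; push_cast; ring,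
    Complex.Gamma_ofReal]
  have hcplx := (Complex.continuous_ofReal.tendsto _).comp hreal
  rw [show (P : ℂ) * ((Real.Gamma (κ + 1) : ℝ) : ℂ)⁻¹ = ((P / Real.Gamma (κ + 1) : ℝ) : ℂ) by
    push_cast; ring]
  refine hcplx.congr' ?_
  filter_upwards [eventually_ge_atTop 2] with x hx
  rw [Function.comp_apply, normaliser_ofReal_eq k y hx]
  push_cast
  ring

end

end Summit.Parity.BatemanHorn.Cruxes.SystemLSDRealSegment.BetaThinnedRootKernel
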